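import Literature.Probability.LatticeModels.FKTwoArcPartitionPolynomials
import Literature.Probability.Percolation.BoxCrossingProofs

/-!
# The Kirchhoff slope of the jointly-wired self-dual FK crossing probability (order `t¹`)

Support file for `KirchhoffExtremalLength` (route CardyUSTContinuation of `CardyFormulaZ2`,
item stmt-CriticalPhenomena-11234), conjunct 1: for every conformal rectangle `R` and all
sufficiently small meshes `δ > 0`, the jointly-wired self-dual random-cluster crossing
probability `u_R(t, δ) = N_δ(t) / Z^joint_δ(t)` (`FKTwoArcPartitionPolynomials`) satisfies
`u_R(t, δ) / t → s(δ)` as `t → 0⁺`, where `s(δ) = [t^{m+1}] N_δ / [t^m] Z^joint_δ`,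
`m = ord_{t=0} Z^joint_δ` (the uniform-spanning-tree limit `q ↓ 0` along the self-dual line,
Grimmett 2006, Thm 1.23: the minimal exponent `|ω| + 2k(ω)` is attained exactly at the spanning
trees of `Ω_δ` with the two discrete arcs identified, none of which crosses).

* §1 limits of ratios of polynomials at a common zero (`tendsto_eval_div_eval_div`);
* §2 removing the first edge of an open crossing between two wired vertices does not change the
  wired cluster count (`exists_erase_clusterCount_eq`), hence crossing configurations have
  exponent `> m` and `N_δ` vanishes to order `m + 1` (`coeff_crossingPolynomial_eq_zero`);
* §3 the slope theorem `eventually_tendsto_crossingProb_div`.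
-/

noncomputable section

namespace Summit.CriticalPhenomena.CardyFormulaZ2.Theorems

namespace KirchhoffSlope

open Filter Topology Polynomial Finset
open Literature.Probability.LatticeModels Literature.Probability.Percolation
open Literature.Probability.RandomPlanarGeometry

/-! ### §1. Ratios of polynomials at a common zero -/

/-- If `Q` vanishes to order exactly `m` at `0` and `P` to order at least `m + 1`, then
`P(t) / Q(t) / t → [t^{m+1}]P / [t^m]Q` as `t → 0⁺`. [folklore] -/
theorem tendsto_eval_div_eval_div {P Q : ℝ[X]} {m : ℕ} (hQ : ∀ d < m, Q.coeff d = 0)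
    (hQm : Q.coeff m ≠ 0) (hP : ∀ d ≤ m, P.coeff d = 0) :
    Tendsto (fun t : ℝ => P.eval t / Q.eval t / t) (𝓝[>] 0)
      (𝓝 (P.coeff (m + 1) / Q.coeff m)) := by
  obtain ⟨Q₁, hQ₁⟩ : X ^ m ∣ Q := Polynomial.X_pow_dvd_iff.2 hQ
  obtain ⟨P₁, hP₁⟩ : X ^ (m + 1) ∣ P :=
    Polynomial.X_pow_dvd_iff.2 fun d hd => hP d (Nat.lt_succ_iff.1 hd)
  have hQ₁0 : Q₁.coeff 0 = Q.coeff m := by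
    rw [hQ₁, mul_comm, Polynomial.coeff_mul_X_pow', if_pos (le_refl m), Nat.sub_self]
  have hP₁0 : P₁.coeff 0 = P.coeff (m + 1) := by
    rw [hP₁, mul_comm, Polynomial.coeff_mul_X_pow', if_pos (le_refl _), Nat.sub_self]
  have hcont : Tendsto (fun t : ℝ => P₁.eval t / Q₁.eval t) (𝓝 0) (𝓝 (P₁.eval 0 / Q₁.eval 0)) := by
    refine (P₁.continuous.tendsto 0).div (Q₁.continuous.tendsto 0) ?_
    rwa [← Polynomial.coeff_zero_eq_eval_zero, hQ₁0]
  rw [← Polynomial.coeff_zero_eq_eval_zero, ← Polynomial.coeff_zero_eq_eval_zero, hQ₁0, hP₁0]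
    at hcont
  refine (hcont.mono_left nhdsWithin_le_nhds).congr' ?_
  filter_upwards [self_mem_nhdsWithin] with t (ht : 0 < t)
  rw [hQ₁, hP₁]
  simp only [Polynomial.eval_mul, Polynomial.eval_pow, Polynomial.eval_X, pow_succ]
  field_simp

/-! ### §2. Crossing configurations are not of minimal exponent -/

section Energy

variable {V : Type*} [DecidableEq V]

/-- Along an open walk avoiding the vertex `a`, no edge through `a` is used, so the walk survives
the removal of such an edge. [folklore] -/
theorem reachable_erase_of_notMem_support {ω : Finset (Sym2 V)} {a v : V} :
    ∀ {x y : V} (q : (openGraph (↑ω : BondConfig V)).Walk x y), a ∉ q.support →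
      (openGraph (↑(ω.erase s(a, v)) : BondConfig V)).Reachable x y := by
  intro x y q
  induction q with
  | nil => exact fun _ => SimpleGraph.Reachable.refl _
  | @cons x x' y hxx' q' ih =>
    intro ha
    rw [SimpleGraph.Walk.support_cons, List.mem_cons, not_or] at ha
    have hx'mem : x' ∈ q'.support := q'.start_mem_support
    have hax' : a ≠ x' := fun h => ha.2 (h ▸ hx'mem)
    obtain ⟨hmem, hne⟩ := (openGraph_adj _ _ _).1 hxx'
    have hadj : (openGraph (↑(ω.erase s(a, v)) : BondConfig V)).Adj x x' := by
      refine (openGraph_adj _ _ _).2 ⟨?_, hne⟩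
      rw [Finset.mem_coe, Finset.mem_erase]
      refine ⟨fun h => ?_, hmem⟩
      rw [Sym2.eq_iff] at h
      rcases h with ⟨h1, -⟩ | ⟨-, h2⟩
      · exact ha.1 h1.symm
      · exact hax' h2.symm
    exact hadj.reachable.trans (ih ha.2)

/-- **Removing the first edge of an open crossing between two wired vertices keeps the wired
cluster count.** If `a ≠ b` both lie in the wired set `W` and are joined by an open path of `ω`,
then for the first edge `e` of such a path, `k^W(ω ∖ e) = k^W(ω)`: the two endpoints of `e` stay
connected through the rest of the path and the wiring `b ∼ a`. [folklore] -/
theorem exists_erase_clusterCount_eq {ω : Finset (Sym2 V)} {W : Set V} {a b : V} (ha : a ∈ W)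
    (hb : b ∈ W) (hab : a ≠ b) (h : (openGraph (↑ω : BondConfig V)).Reachable a b) :
    ∃ e ∈ ω, clusterCount (↑(ω.erase e) : BondConfig V) W = clusterCount (↑ω : BondConfig V) W := by
  classical
  obtain ⟨p, hp⟩ : ∃ p : (openGraph (↑ω : BondConfig V)).Walk a b, p.IsPath :=
    ⟨h.some.toPath, h.some.toPath.2⟩
  cases p with
  | nil => exact absurd rfl hab
  | @cons _ v _ hav p' =>
    obtain ⟨hmem, hne⟩ := (openGraph_adj _ _ _).1 hav
    refine ⟨s(a, v), hmem, ?_⟩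
    rw [SimpleGraph.Walk.cons_isPath_iff] at hp
    -- the smaller and the larger wired open graphs
    set H' := openGraph (↑(ω.erase s(a, v)) : BondConfig V) ⊔ wired W with hH'
    set H := openGraph (↑ω : BondConfig V) ⊔ wired W with hH
    have hle : H' ≤ H :=
      sup_le_sup_right (openGraph_mono (Finset.coe_subset.2 (Finset.erase_subset _ _))) _
    have hvb : H'.Reachable v b :=
      (reachable_erase_of_notMem_support p' hp.2).mono le_sup_left
    have hba : H'.Reachable b a := (reachable_wired hb ha).mono le_sup_right
    have hav' : H'.Reachable a v := (hvb.trans hba).symm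
    have key : ∀ x y, H.Reachable x y → H'.Reachable x y := by
      intro x y hxy
      refine reachable_le_of_adj_le (r := H'.Reachable) (fun _ => SimpleGraph.Reachable.refl _)
        (fun _ _ _ => SimpleGraph.Reachable.trans) ?_ hxy
      rintro x y (hxy | hxy)
      · obtain ⟨hm, hn⟩ := (openGraph_adj _ _ _).1 hxy
        by_cases he : s(x, y) = s(a, v)
        · rw [Sym2.eq_iff] at he
          rcases he with ⟨rfl, rfl⟩ | ⟨rfl, rfl⟩
          · exact hav'
          · exact hav'.symm
        · refine SimpleGraph.Adj.reachable (le_sup_left (α := SimpleGraph V) ?_)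
          refine (openGraph_adj _ _ _).2 ⟨?_, hn⟩
          rw [Finset.mem_coe, Finset.mem_erase]
          exact ⟨he, hm⟩
      · exact ((le_sup_right : wired W ≤ H') hxy).reachable
    -- same reachability ⇒ same number of components
    refine Nat.card_congr (Equiv.ofBijective (SimpleGraph.ConnectedComponent.map
      (SimpleGraph.Hom.ofLE hle)) ⟨?_, SimpleGraph.ConnectedComponent.surjective_map_ofLE hle⟩)
    refine SimpleGraph.ConnectedComponent.ind₂ fun x y hxy => ?_
    simp only [SimpleGraph.ConnectedComponent.map_mk, SimpleGraph.Hom.coe_ofLE, id_eq,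
      SimpleGraph.ConnectedComponent.eq] at hxy
    exact SimpleGraph.ConnectedComponent.sound (key x y hxy)

end Energy

/-! ### §3. Orders of vanishing of `Z` and `N` at `t = 0` -/

section Coefficients

variable {V : Type*} [Fintype V] [DecidableEq V] (G : SimpleGraph V) [DecidableRel G.Adj]

omit [DecidableEq V] in
/-- Every configuration `ω ⊆ E(G)` contributes to the coefficient of `t^{|ω| + 2k^w(ω)}` of `Z^w_G`,
so the order of vanishing of `Z^w_G` at `0` is at most that exponent. [folklore] -/
theorem natTrailingDegree_le_exponent (B₁ B₂ : Set V) (w : ArcWiring) {ω : Finset (Sym2 V)}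
    (hω : ω ⊆ G.edgeFinset) :
    (rcArcPolynomial G B₁ B₂ w).natTrailingDegree ≤
      #ω + 2 * arcClusterCount (↑ω : BondConfig V) B₁ B₂ w := by
  refine Polynomial.natTrailingDegree_le_of_ne_zero ?_
  rw [rcArcPolynomial, Polynomial.finsetSum_coeff]
  refine Nat.pos_iff_ne_zero.1 (lt_of_lt_of_le Nat.one_pos ?_)
  refine le_trans ?_ (Finset.single_le_sum (f := fun ω' : Finset (Sym2 V) =>
    ((X : ℕ[X]) ^ (#ω' + 2 * arcClusterCount (↑ω' : BondConfig V) B₁ B₂ w)).coeff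
      (#ω + 2 * arcClusterCount (↑ω : BondConfig V) B₁ B₂ w)) (fun _ _ => Nat.zero_le _)
    (Finset.mem_powerset.2 hω))
  simp

/-- **Crossing configurations are not of minimal exponent.** For disjoint wired sets `B₁, B₂`,
a configuration `ω ⊆ E(G)` joining `B₁` to `B₂` by an open path has exponent
`|ω| + 2 k^{B₁ ∪ B₂}(ω) ≥ ord₀ Z^joint_G + 1` (remove the first edge of the crossing:
`exists_erase_clusterCount_eq`). [folklore] -/
theorem natTrailingDegree_lt_exponent_of_mem_arcCrossing {B₁ B₂ : Set V} (hdisj : Disjoint B₁ B₂)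
    {ω : Finset (Sym2 V)} (hω : ω ⊆ G.edgeFinset)
    (hcross : (↑ω : BondConfig V) ∈ arcCrossing B₁ B₂) :
    (rcArcPolynomial G B₁ B₂ .joint).natTrailingDegree <
      #ω + 2 * arcClusterCount (↑ω : BondConfig V) B₁ B₂ .joint := by
  obtain ⟨a, ha, b, hb, hab⟩ := hcross
  have hne : a ≠ b := fun h => hdisj.ne_of_mem ha hb h
  obtain ⟨e, he, hk⟩ := exists_erase_clusterCount_eq (W := B₁ ∪ B₂) (Or.inl ha) (Or.inr hb) hne hab
  have h1 := natTrailingDegree_le_exponent G B₁ B₂ .joint ((Finset.erase_subset e ω).trans hω)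
  rw [arcClusterCount_joint, hk, ← arcClusterCount_joint, Finset.card_erase_of_mem he] at h1
  have hpos : 0 < #ω := Finset.card_pos.2 ⟨e, he⟩
  omega

/-- Hence the crossing-restricted polynomial `N^joint_G` (restricted to any sub-event of the
crossing event) has no coefficients of degree `≤ ord₀ Z^joint_G`. [folklore] -/
theorem coeff_rcArcPolynomialIn_eq_zero {B₁ B₂ : Set V} (hdisj : Disjoint B₁ B₂)
    {U : Set (BondConfig V)} (hU : U ⊆ arcCrossing B₁ B₂) {j : ℕ}
    (hj : j ≤ (rcArcPolynomial G B₁ B₂ .joint).natTrailingDegree) :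
    (rcArcPolynomialIn G U B₁ B₂ .joint).coeff j = 0 := by
  classical
  rw [rcArcPolynomialIn, Polynomial.finsetSum_coeff]
  refine Finset.sum_eq_zero fun ω hω => ?_
  rw [Finset.mem_filter, Finset.mem_powerset] at hω
  rw [Polynomial.coeff_X_pow, if_neg]
  have := natTrailingDegree_lt_exponent_of_mem_arcCrossing G hdisj hω.1 (hU hω.2)
  omega

end Coefficients

/-! ### §4. The slope of the crossing probability at `t = 0⁺` -/

/-- **The Kirchhoff slope (conjunct 1 of `KirchhoffExtremalLength`).** For every conformal
rectangle `R` and all sufficiently small meshes `δ > 0` (small enough that the discrete arcs of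
`(ab)` and `(cd)` are disjoint), the jointly-wired self-dual random-cluster crossing probability
`u_R(t, δ)` of `Ω_δ` (the function `uJ` of the route file, `= N_δ(t)/Z^joint_δ(t)`) satisfies
`u_R(t, δ)/t → [t^{m+1}] N_δ / [t^m] Z^joint_δ` as `t → 0⁺`, `m = ord₀ Z^joint_δ` (Grimmett 2006,
Thm 1.23: the uniform-spanning-tree limit `q ↓ 0` on the self-dual line).
[cite: Grimmett2006, Thm 1.23] -/
theorem eventually_tendsto_crossingProb_div (R : ConformalRectangle) :
    ∀ᶠ δ in 𝓝[>] (0 : ℝ), Tendsto (fun t : ℝ =>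
      (if h : 0 < δ then (@fkDomainMeasure R.carrier δ (t / (1 + t)) (t ^ 2) (R.arc 0 ∪ R.arc 2)
        (meshDomain_finite R.isBounded h).fintype).real
          (discreteCrossing R.carrier δ (R.arc 0) (R.arc 2)) else 0) / t) (𝓝[>] 0)
      (𝓝 (((fkTwoArcCrossingPolynomial R δ .joint).coeff
              ((fkTwoArcPartitionPolynomials R δ .joint).natTrailingDegree + 1) : ℝ) /
            ((fkTwoArcPartitionPolynomials R δ .joint).coeff
              (fkTwoArcPartitionPolynomials R δ .joint).natTrailingDegree : ℝ))) := by
  classical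
  obtain ⟨δ₀, hδ₀, hdisj⟩ := eventually_discreteArc_inter_eq_empty R
  filter_upwards [Ioo_mem_nhdsGT hδ₀] with δ hδ
  have hδp : 0 < δ := hδ.1
  letI : Fintype (meshDomain R.carrier δ) := (meshDomain_finite R.isBounded hδp).fintype
  set Z := fkTwoArcPartitionPolynomials R δ .joint with hZdef
  set N := fkTwoArcCrossingPolynomial R δ .joint with hNdef
  set m := Z.natTrailingDegree with hmdef
  -- the discrete arcs are disjoint
  have hdA : Disjoint (rectArc R δ 0) (rectArc R δ 2) := by
    rw [Set.disjoint_iff_inter_eq_empty, rectArc, rectArc, ← Set.preimage_inter, hdisj δ hδp hδ.2,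
      Set.preimage_empty]
  -- orders of vanishing
  have hZ : Z = rcArcPolynomial (domainSubgraph R.carrier δ) (rectArc R δ 0) (rectArc R δ 2) .joint :=
    fkTwoArcPartitionPolynomials_of_pos R hδp _
  have hN : N = rcArcPolynomialIn (domainSubgraph R.carrier δ)
      (arcCrossing (rectArc R δ 0) (rectArc R δ 2)) (rectArc R δ 0) (rectArc R δ 2) .joint :=
    fkTwoArcCrossingPolynomial_eq_rcArcPolynomialIn R hδp _
  have hZ0 : Z ≠ 0 := fkTwoArcPartitionPolynomials_ne_zero R hδp _
  have hQm : Z.coeff m ≠ 0 := Polynomial.trailingCoeff_nonzero_iff_nonzero.2 hZ0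
  have hQ : ∀ d < m, Z.coeff d = 0 := fun d hd => Polynomial.coeff_eq_zero_of_lt_natTrailingDegree hd
  have hP : ∀ d ≤ m, N.coeff d = 0 := fun d hd => by
    rw [hN]
    refine coeff_rcArcPolynomialIn_eq_zero _ hdA subset_rfl ?_
    rwa [← hZ]
  -- the limit of the ratio of the real polynomials
  have key := tendsto_eval_div_eval_div (P := N.map (algebraMap ℕ ℝ)) (Q := Z.map (algebraMap ℕ ℝ))
    (m := m) (fun d hd => by rw [Polynomial.coeff_map, hQ d hd, map_zero])
    (by rw [Polynomial.coeff_map, eq_natCast, Nat.cast_ne_zero]; exact hQm)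
    (fun d hd => by rw [Polynomial.coeff_map, hP d hd, map_zero])
  rw [Polynomial.coeff_map, Polynomial.coeff_map, eq_natCast, eq_natCast] at key
  refine key.congr' ?_
  filter_upwards [self_mem_nhdsWithin] with t (ht : 0 < t)
  rw [dif_pos hδp, measureReal_fkDomainMeasure_discreteCrossing R hδp ht, Polynomial.aeval_def,
    Polynomial.aeval_def, Polynomial.eval₂_eq_eval_map, Polynomial.eval₂_eq_eval_map]

end KirchhoffSlope

end Summit.CriticalPhenomena.CardyFormulaZ2.Theorems
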